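import Summits.BirchSwinnertonDyer.Rank1Residual.Additive.TameBranchExtraZerosLaw
import HarnessLib

/-!
# THE EXTRA ZEROS' CONTRIBUTION at rank one — Delbourgo 2002 (B) + the RATIONAL Kato half (C) + a
# tame branch with FIRST TOP at `n = λ_an` and `[T¹]B ≠ 0`: Schneider, `1 ≤ λ(X) ≤ λ_an`, and
# `ord Ш[p^∞] + ord Reg_p + ord ∏c + ord ℓ ≤ μ(X) + ord_p[T¹]B + c + 1 + 2 ord #tors`, EQUALITY iff
# `λ(X) = λ_an` (cell `b2b-bsdres`, sub-cell additive-p2 = X3♯(G-ord)/X4♯(G-ord), gen 29; part 2 of 3)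

HONEST FRAMING (cell `b2b-bsdres`, run/shared/lean/b2b/bsd-rank1-residual/, verbatim in every
file): the goal of the cell is to DELETE the COMBINATION-SHAPED residual classes of the
Birch–Swinnerton-Dyer formula for ALL analytic-rank `≤ 1` elliptic curves over `ℚ` — "full BSD
formula for every rank `≤ 1` curve in class `C`" assembled STRICTLY from published theorems — so
that the rank-`≤ 1` remainder becomes exactly the CONSTRUCTION-SHAPED classes, which are TYPED
(missing-input `Prop`s), NOT attempted. This is not "finishing BSD". Sub-cell additive-p2: the
classes X3♯(G-ord) / X4♯(G-ord) are CONSTRUCTION-SHAPED and stay so; labels / RESIDUAL-MAP marks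
UNCHANGED; nothing is booked. Theorems only; the published inputs are hypothesis binders (Delbourgo
2002 (B) as `LeadingTermClauses W p Dh`, (C) as the typed Kato half `TameBranchRatDvdAt W p` = A227 via
`tameBranchRatDvdAt_of_thmC`). No definition, no named fact, no `sorry`.

## What and why

At `rank_ℤ E(ℚ) = 1` with the RATIONAL Kato half `ι g = p^k·B` (`g ∈ char_Λ X = (fE)`, `k` unknown)
and a tame branch `B` bounded by `p^c` whose FIRST TOP coefficient sits at `n` (`= λ_an`, the census's
two-value certificate) with `[T¹]B ≠ 0` (one Riemann sum beyond the truncation error), part 1's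
Λ-algebra and Delbourgo 2002 (B) give, for every cyclotomic dual datum with generator `fE`:

* Schneider (`Reg_p(E,Dh) ≠ 0`) and `#Ш[p^∞] < ∞` (clause 2: `ord_T fE = 1 = rank`, gen 28);
* **`1 ≤ λ(fE) ≤ n`** (`λ(g) = n`, `λ` additive);
* **`ord_p #Ш[p^∞] + ord_p Reg_p(E,Dh) + ord_p ∏c + ord_p ℓ ≤ μ(fE) + ord_p[T¹]B + c + 1 + 2·ord_p #E(ℚ)_tors`**
  (clause 3: `[T¹]fE·log_p γ·#tors² = u·ℓ·#Ш[p^∞]·Reg_p·∏c`, `ord_p log_p γ = 1`, and part 1's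
  `ord_p[T¹]fE ≤ μ(fE) + ord_p[T¹]B + c`), **with EQUALITY iff `λ(fE) = n`** — iff the cofactor
  `h = g/fE` has no zeros, i.e. iff every zero of the analytic branch beyond `T = 0` is a zero of
  `char_Λ X(E/ℚ_∞)`: **the λ-part of the main conjecture at the pair** (Greenberg–Vatsal's `λ_alg = λ_an`).
  The extra zeros' contribution `ord_p[T¹]B + c` is `ord_p` of the product of the zeros of `B` other than
  `T = 0` (`= 0` iff `n = 1`, recovering gen 20's identity `… = μ(fE) + 1 + 2 ord #tors`).

* §2 `schneider_and_padicVal_le_rankOne_of_iota_eq_of_firstTop` — the cell-agnostic core per datum;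
* §3 **`schneider_and_padicVal_le_rankOne_of_tameBranchRatDvdAt_of_firstTop`** — every defect ((M)
  included): `TameBranchRatDvdAt W p` + ANY tuple `(f, ε, α, B)` of the package with a first top at `n`
  and `[T¹]B ≠ 0`.

What this does NOT give: `μ(fE)` (an INTEGRAL (C) off defect 2 is not in print); the UPPER half;
any booking. The RATIONAL (C) bounds the ALGEBRAIC extra-zero contribution `ord_p[T¹]fE − μ(fE)` by
the ANALYTIC one; equality is the λ-part of MC, which the rational main conjecture
`TameBranchRatCharEqAt` would supply. Part 3 feeds the census inputs (two values + one Riemann sum).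

References: Delbourgo 2002 Thm. (A), (B), (C) p. 40 [Delbourgo2002]; Washington GTM 83 §7.1
[Washington1997]; Greenberg–Vatsal 2000 p. 4 [GreenbergVatsal2000]; `GordCycRankOneLambda.lean`
(n1011-p01), `GordRankOneKatoUpperBound.lean` (gen 19), `TameBranchKatoDivisibilityRankOne.lean` (gen 20),
`TameBranchTwoValueSimpleZero.lean` (gen 28). -/

set_option autoImplicit false

noncomputable section

open scoped Classical MatrixGroups ModularForm NumberField

open CongruenceSubgroup IsDedekindDomain WeierstrassCurve NumberField
  Literature.NumberTheory.EllipticCurves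
  Literature.NumberTheory.EllipticCurves.ModularForms
  Literature.NumberTheory.EllipticCurves.Rank1Residual
  Literature.NumberTheory.EllipticCurves.Rank1Residual.Typed
  Literature.NumberTheory.EllipticCurves.Delbourgo2002
  Summit.BirchSwinnertonDyer.Rank1Residual.X1.MuLambda
  Summit.BirchSwinnertonDyer.Rank1Residual.X1.RankOneParitySqueeze
  Summit.BirchSwinnertonDyer.Rank1Residual.X11a.LambdaNorm

namespace Summit.BirchSwinnertonDyer.Rank1Residual.Additive

/-! ### §2 The cell-agnostic core at rank one: Schneider, `1 ≤ λ(fE) ≤ n`, and the leading-term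
INEQUALITY with the extra zeros' contribution — EQUALITY iff `λ(fE) = n` -/

section Core

open TameBranchExtraZeros

variable {W : WeierstrassCurve ℚ} [W.IsElliptic] {p : ℕ} [hp : Fact p.Prime]

/-- **Core (per cyclotomic datum).** `p ≠ 2`, `rank_ℤ E(ℚ) = 1`, a (B)-datum `Dh` (`hBcl`), a
cyclotomic dual datum `D` with `X` torsion and generator `fE`, `g ∈ char_Λ X` with `ι g = p^k·B`,
`‖[Tʲ]B‖ ≤ p^c` for all `j`, FIRST TOP coefficient at `n` (`‖[Tⁿ]B‖ = p^c`, `‖[Tⁱ]B‖ < p^c` for `i < n`)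
and `[T¹]B ≠ 0`. Then: Schneider (`Reg_p(E,Dh) ≠ 0`), `#Ш[p^∞] < ∞`, `1 ≤ λ(fE) ≤ n`, and with
Delbourgo's `ℓ ∣ p²` (`= 1` off the anomalous rows)
**`ord_p #Ш[p^∞] + ord_p Reg_p(E,Dh) + ord_p ∏c + ord_p ℓ ≤ μ(fE) + ord_p[T¹]B + c + 1 + 2 ord_p #E(ℚ)_tors`,
with EQUALITY iff `λ(fE) = n`** (the cofactor `h = g/fE` has `λ(h) = 0`, i.e. every zero of `B`
beyond `T = 0` is a zero of `char_Λ X`). For `n = 1` (`ord_p[T¹]B = −c`) this is gen 20's identity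
`… = μ(fE) + 1 + 2 ord_p #tors`. [cite: Delbourgo2002, Theorem (B) (p. 40)] [cite: Washington1997, §7.1] -/
theorem schneider_and_padicVal_le_rankOne_of_iota_eq_of_firstTop (hp2 : p ≠ 2)
    (hr1 : W.mordellWeilRank = 1) {Dh : PAdicHeightData W p} (hBcl : LeadingTermClauses W p Dh)
    {κ : ZpExtension ℚ p} {γ : Field.absoluteGaloisGroup ℚ}
    (hκ : κ.IsCyclotomic) (hγ : κ.IsTopGenerator γ) (hγ' : IsCyclotomicVariable p γ)
    (D : W.SelmerDualData κ γ) [Module.Finite (IwasawaAlgebra p) D.X] (hX : D.IsTorsion)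
    {fE g : IwasawaAlgebra p} (hchar : D.charIdeal = Ideal.span {fE}) (hg : g ∈ D.charIdeal)
    {k c : ℕ} {B : PowerSeries ℚ_[p]}
    (hι : iwasawaToPowerSeries p g = PowerSeries.C ((p : ℚ_[p]) ^ k) * B)
    (hbd : ∀ j : ℕ, ‖PowerSeries.coeff j B‖ ≤ (p : ℝ) ^ c)
    {n : ℕ} (hn : ‖PowerSeries.coeff n B‖ = (p : ℝ) ^ c)
    (hlt : ∀ i < n, ‖PowerSeries.coeff i B‖ < (p : ℝ) ^ c) (hB1 : PowerSeries.coeff 1 B ≠ 0) :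
    SchneiderConjecture Dh ∧ Finite (AddCommGroup.primaryComponent W.sha p) ∧
      1 ≤ X1.MuLambda.lam fE ∧ X1.MuLambda.lam fE ≤ n ∧
      ∃ ℓ : ℕ, ℓ ∣ p ^ 2 ∧ (ReductionNonAnomalous W p → ℓ = 1) ∧
        (padicValNat p (Nat.card (AddCommGroup.primaryComponent W.sha p)) : ℤ) +
            (padicRegulator Dh).valuation + padicValNat p W.tamagawaProduct + padicValNat p ℓ ≤
          X1.MuLambda.mu fE + (PowerSeries.coeff 1 B).valuation + c + 1 +
            2 * padicValNat p W.torsionOrder ∧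
        ((padicValNat p (Nat.card (AddCommGroup.primaryComponent W.sha p)) : ℤ) +
            (padicRegulator Dh).valuation + padicValNat p W.tamagawaProduct + padicValNat p ℓ =
          X1.MuLambda.mu fE + (PowerSeries.coeff 1 B).valuation + c + 1 +
            2 * padicValNat p W.torsionOrder ↔ X1.MuLambda.lam fE = n) := by
  have hpP : p.Prime := hp.out
  have hpQ : (p : ℚ_[p]) ≠ 0 := Nat.cast_ne_zero.mpr hpP.ne_zero
  -- the factorisation `g = fE · h`
  have hg' := hg
  rw [hchar] at hg'
  obtain ⟨h, hh⟩ := Ideal.mem_span_singleton'.mp hg'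
  have hfac : g = fE * h := by rw [← hh, mul_comm]
  -- `fE(0) = 0` by clause 1 of (B) at rank one
  have hcl := hBcl κ γ hκ hγ hγ' D hX fE hchar
  have hord1 : (1 : ℕ∞) ≤ fE.order := by
    have h1 := hcl.1
    rwa [hr1, Nat.cast_one] at h1
  have hf0 : PowerSeries.constantCoeff fE = 0 := by
    rw [← PowerSeries.coeff_zero_eq_constantCoeff_apply]
    exact PowerSeries.coeff_of_lt_order 0 (lt_of_lt_of_le (by exact_mod_cast Nat.zero_lt_one) hord1)
  -- the Λ-algebra core
  obtain ⟨hf1, hle⟩ := valuation_coeff_one_le hfac hι hbd hf0 hB1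
  have hiff := valuation_coeff_one_eq_iff hfac hι hbd hn hf0 hB1
  have hg0 : g ≠ 0 := by
    intro h0
    have : ((PowerSeries.coeff 1 g : ℤ_[p]) : ℚ_[p]) = (p : ℚ_[p]) ^ k * PowerSeries.coeff 1 B := by
      rw [← Wuthrich2014.coeff_iwasawaToPowerSeries p g 1, hι, PowerSeries.coeff_C_mul]
    rw [h0] at this
    simp only [map_zero, PadicInt.coe_zero] at this
    exact (mul_ne_zero (pow_ne_zero _ hpQ) hB1) this.symm
  have hlamg : lam g = n := lam_eq_of_iota_eq_of_firstTop hg0 hι hbd hn hlt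
  have hfE0 : fE ≠ 0 := by intro h0; apply hg0; rw [hfac, h0, zero_mul]
  have hh0 : h ≠ 0 := by intro h0; apply hg0; rw [hfac, h0, mul_zero]
  have hlam_mul : lam g = lam fE + lam h := by rw [hfac]; exact lam_mul hfE0 hh0
  -- `ord_T fE = 1`
  have hf1Z : PowerSeries.coeff 1 fE ≠ 0 := by
    intro e; apply hf1; rw [e]; simp
  have horder : fE.order = 1 := by
    rw [← Nat.cast_one (R := ℕ∞), PowerSeries.order_eq_nat]
    refine ⟨hf1Z, fun i hi ↦ ?_⟩
    have hi0 : i = 0 := by omega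
    subst hi0
    rw [PowerSeries.coeff_zero_eq_constantCoeff_apply]; exact hf0
  have horder' : fE.order = W.mordellWeilRank := by rw [hr1, horder, Nat.cast_one]
  obtain ⟨hS, hfin⟩ := hcl.2.1.mp horder'
  -- `1 ≤ λ(fE) ≤ n`
  have hlam1 : 1 ≤ lam fE := by
    have h1 := order_le_lam hfE0
    rw [horder] at h1
    exact_mod_cast h1
  have hlamn : lam fE ≤ n := by rw [← hlamg, hlam_mul]; exact Nat.le_add_right _ _
  -- clause 3 of (B)
  obtain ⟨u, ℓ, hℓp, hℓ1, heq⟩ := hcl.2.2 hS hfin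
  rw [hr1, pow_one] at heq
  refine ⟨hS, hfin, hlam1, hlamn, ℓ, hℓp, hℓ1, ?_⟩
  obtain ⟨w, hw⟩ := exists_unit_padicLog_cyclotomicGenerator (p := p) hp2
  have hlog0 : padicLog p (cyclotomicGenerator p : ℚ_[p]) ≠ 0 := by
    rw [hw]; exact mul_ne_zero hpQ (coe_units_ne_zero p w)
  have hlogv : (padicLog p (cyclotomicGenerator p : ℚ_[p])).valuation = 1 := by
    rw [hw, Padic.valuation_mul hpQ (coe_units_ne_zero p w), Padic.valuation_p,
      valuation_coe_units_eq_zero, add_zero]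
  have hT0 : W.torsionOrder ≠ 0 := (W.torsionOrder_pos_holds).ne'
  have hTQ : (W.torsionOrder : ℚ_[p]) ≠ 0 := by exact_mod_cast hT0
  have hu0 : ((u : ℤ_[p]) : ℚ_[p]) ≠ 0 := coe_units_ne_zero p u
  have hℓ0 : ℓ ≠ 0 := by
    rintro rfl
    exact hpP.ne_zero (pow_eq_zero_iff (n := 2) (by norm_num) |>.mp (zero_dvd_iff.mp hℓp))
  have hℓQ : (ℓ : ℚ_[p]) ≠ 0 := by exact_mod_cast hℓ0
  haveI : Finite (AddCommGroup.primaryComponent W.sha p) := hfin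
  have hShp0 : (Nat.card (AddCommGroup.primaryComponent W.sha p) : ℚ_[p]) ≠ 0 := by
    exact_mod_cast Nat.card_pos.ne'
  have hRg0 : padicRegulator Dh ≠ 0 := hS
  have hCc0 : (W.tamagawaProduct : ℚ_[p]) ≠ 0 := by
    exact_mod_cast (W.tamagawaProduct_pos_holds : 0 < W.tamagawaProduct).ne'
  have hL : (((PowerSeries.coeff 1 fE : ℤ_[p]) : ℚ_[p]) *
        padicLog p (cyclotomicGenerator p) * (W.torsionOrder : ℚ_[p]) ^ 2).valuation =
      (((PowerSeries.coeff 1 fE : ℤ_[p]) : ℚ_[p])).valuation + 1 +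
        2 * (padicValNat p W.torsionOrder : ℤ) := by
    rw [Padic.valuation_mul (mul_ne_zero hf1 hlog0) (pow_ne_zero 2 hTQ),
      Padic.valuation_mul hf1 hlog0, Padic.valuation_pow, hlogv, Padic.valuation_natCast]
    push_cast
    ring
  have hR : (((u : ℤ_[p]) : ℚ_[p]) * (ℓ : ℚ_[p]) *
        ((Nat.card (AddCommGroup.primaryComponent W.sha p) : ℚ_[p]) * padicRegulator Dh *
          (W.tamagawaProduct : ℚ_[p]))).valuation =
      (padicValNat p ℓ : ℤ) +
        ((padicValNat p (Nat.card (AddCommGroup.primaryComponent W.sha p)) : ℤ) +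
          (padicRegulator Dh).valuation + padicValNat p W.tamagawaProduct) := by
    rw [Padic.valuation_mul (mul_ne_zero hu0 hℓQ) (mul_ne_zero (mul_ne_zero hShp0 hRg0) hCc0),
      Padic.valuation_mul hu0 hℓQ, valuation_coe_units_eq_zero, zero_add, Padic.valuation_natCast,
      Padic.valuation_mul (mul_ne_zero hShp0 hRg0) hCc0, Padic.valuation_mul hShp0 hRg0,
      Padic.valuation_natCast, Padic.valuation_natCast]
  have hval := congrArg Padic.valuation heq
  rw [hL, hR] at hval
  refine ⟨by linarith, ?_⟩
  rw [← hlamg, ← hiff]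
  constructor
  · intro e; linarith
  · intro e; linarith

end Core

/-! ### §3 Every defect ((M) included): the typed Kato half + ANY tuple with a first top at `n` and
`[T¹]B ≠ 0` -/

section EveryDefect

open TameBranchExtraZeros

variable {W : WeierstrassCurve ℚ} [W.IsElliptic] [W.IsGloballyMinimal] {p : ℕ} [hp : Fact p.Prime]
  {N : ℕ} [NeZero N] {f : CuspForm (Gamma0 N) 2}

/-- **THE EXTRA ZEROS' CONTRIBUTION, every defect ((M) included).** `p ≠ 2` additive of type (M) or
(G-ord), `TameBranchRatDvdAt W p` (Delbourgo 2002 (C): `ι g = p^k·B`, `g ∈ char_Λ X`), ANY tuple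
`(f, ε, α, B)` with `IsTameBranchOf f p ε α B`, `orderOf ε = tameDefect`, `‖α‖ = 1`, coefficient bound
`p^c` with FIRST TOP at `n` (`= λ_an`) and `[T¹]B ≠ 0`, `rank_ℤ E(ℚ) = 1` and a (B)-datum `Dh`. Then
for every cyclotomic dual datum with generator `fE`: Schneider, `#Ш[p^∞] < ∞`, `1 ≤ λ(fE) ≤ n`, and
**`ord_p #Ш[p^∞] + ord_p Reg_p(E,Dh) + ord_p ∏c + ord_p ℓ ≤ μ(fE) + ord_p[T¹]B + c + 1 + 2 ord_p #tors`,
EQUALITY iff `λ(fE) = n`** — the RATIONAL (C) leaves `μ(fE) ≥ 0` free and bounds the extra zeros'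
contribution by the analytic one, `ord_p[T¹]B + c = ord_p` of the product of the zeros of `B` other than
`T = 0`; the λ-part of the main conjecture at the pair (`λ(char_Λ X) = λ_an`) is EQUIVALENT to equality.
[cite: Delbourgo2002, Theorem (A), (B), (C) (p. 40)] [cite: Washington1997, §7.1] -/
theorem schneider_and_padicVal_le_rankOne_of_tameBranchRatDvdAt_of_firstTop
    (hT : TameBranchRatDvdAt W p)
    {ε : DirichletCharacter ℂ_[p] p} {α : ℚ_[p]} {B : PowerSeries ℚ_[p]}
    (hp2 : p ≠ 2) (hadd : Addv W p) (hloc : PotMult W p ∨ TypeGOrd W p)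
    (hf : IsNewformOf W f) (hε : orderOf ε = tameDefect W p) (hα : ‖α‖ = 1)
    (hB : IsTameBranchOf f p ε α B) {c : ℕ} (hbd : ∀ j : ℕ, ‖PowerSeries.coeff j B‖ ≤ (p : ℝ) ^ c)
    {n : ℕ} (hn : ‖PowerSeries.coeff n B‖ = (p : ℝ) ^ c)
    (hlt : ∀ i < n, ‖PowerSeries.coeff i B‖ < (p : ℝ) ^ c) (hB1 : PowerSeries.coeff 1 B ≠ 0)
    (hr1 : W.mordellWeilRank = 1) {Dh : PAdicHeightData W p} (hBcl : LeadingTermClauses W p Dh)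
    {κ : ZpExtension ℚ p} {γ : Field.absoluteGaloisGroup ℚ}
    (hκ : κ.IsCyclotomic) (hγ : κ.IsTopGenerator γ) (hγ' : IsCyclotomicVariable p γ)
    (D : W.SelmerDualData κ γ) [Module.Finite (IwasawaAlgebra p) D.X]
    {fE : IwasawaAlgebra p} (hchar : D.charIdeal = Ideal.span {fE}) :
    SchneiderConjecture Dh ∧ Finite (AddCommGroup.primaryComponent W.sha p) ∧
      1 ≤ X1.MuLambda.lam fE ∧ X1.MuLambda.lam fE ≤ n ∧
      ∃ ℓ : ℕ, ℓ ∣ p ^ 2 ∧ (ReductionNonAnomalous W p → ℓ = 1) ∧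
        (padicValNat p (Nat.card (AddCommGroup.primaryComponent W.sha p)) : ℤ) +
            (padicRegulator Dh).valuation + padicValNat p W.tamagawaProduct + padicValNat p ℓ ≤
          X1.MuLambda.mu fE + (PowerSeries.coeff 1 B).valuation + c + 1 +
            2 * padicValNat p W.torsionOrder ∧
        ((padicValNat p (Nat.card (AddCommGroup.primaryComponent W.sha p)) : ℤ) +
            (padicRegulator Dh).valuation + padicValNat p W.tamagawaProduct + padicValNat p ℓ =
          X1.MuLambda.mu fE + (PowerSeries.coeff 1 B).valuation + c + 1 +
            2 * padicValNat p W.torsionOrder ↔ X1.MuLambda.lam fE = n) := by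
  obtain ⟨hX, g, hg, k, hι⟩ := hT ε α B hp2 hadd hloc hκ hγ hγ' hf hε hα hB D
  exact schneider_and_padicVal_le_rankOne_of_iota_eq_of_firstTop hp2 hr1 hBcl hκ hγ hγ' D hX hchar hg hι
    hbd hn hlt hB1

end EveryDefect

end Summit.BirchSwinnertonDyer.Rank1Residual.Additive

end
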